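import Summits.HodgeConjecture.CorCM.GaloisNonNormalPrimeOrder
import Mathlib.LinearAlgebra.Matrix.GeneralLinearGroup.Defs
import HarnessLib

/-!
# `Gal(K/ℚ) ≅ GL(2,3)` (order `48`, complex conjugation `-1`): simple DEGENERATE CM abelian 24-folds by the FAMILY form of the
# skew-section count — a non-central involution with `12` conjugates, below gen 32's threshold `64`

COR-CM (cell `pub-hodgecm2`), binder seat b04 (gen 33), count-neutral own lane «Galois-CM-type classification».  KERNEL ONLY:
theorems; no definition, no named fact, no `sorry`.  `HC_CM` is neither used nor claimed.  Gen 32's theorem (a non-central involution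
⟹ BAD) needs `|G| ≥ 64`; the refined count of gen 33 (`CorCM/GaloisSkewSectionPrime`: fibres of size `n/m`, `m` = number of
conjugates) succeeds for `GL(2,3)` at order `48`: `u = diag(1,-1)` has `m = 12` conjugates (`n = 12`, `s = 1`), and
`48·2⁶ + m·2^((12 + 12/m)/2) < 2¹²` for every `m ≥ 3` dividing `12` (it FAILS at `m = 2` by equality — hence three conjugators are
exhibited, by `decide +kernel` on `GL (Fin 2) (ZMod 3)`).  `GL(2,3)` has no abelian subgroup of index two, its normal subgroups
`≠ 1` all contain `-1`, and its one index-two subgroup `SL(2,3)` contains `-1`: no imaginary quadratic subfield, no totally real Galois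
factor — none of the seat's earlier criteria applies.

* `exists_simple_degenerate_of_mulEquiv_gl_two_three` — **`Gal(K/ℚ) ≅ GL(2,3)` ⟹ a simple DEGENERATE abelian `24`-fold with CM by
  `K`**, through `CorCM/GaloisNonNormalPrimeOrder.exists_simple_degenerate_of_involution_three_conjugates` (order `48`, an involution
  with three conjugates; the complex conjugation — necessarily `-1` — need not be located).

## References

* [Shimura1998] G. Shimura, *Abelian Varieties with Complex Multiplication and Modular Functions*, §6.2 Thm. 3, §8.2 Prop. 26, §32.10.
* [Gordon1999HodgeAVSurvey] B. B. Gordon, *A survey of the Hodge conjecture for abelian varieties*, Thm. 6.4, §9.3.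
-/

noncomputable section

open CategoryTheory CategoryTheory.Limits NumberField
open scoped BigOperators MatrixGroups

namespace Summit.HodgeConjecture.CorCM.GaloisModels

open Literature.NumberTheory.ComplexMultiplication
open Literature.AlgebraicGeometry.Motives (AbelianVariety CMType)
open Literature.AlgebraicGeometry.HodgeTheory
open Literature.AlgebraicGeometry.ComplexMultiplication (IsCMTypeRealisation)
open Literature.AlgebraicGeometry.Pohlmann1968
open Literature.Barriers.HodgeConjecture (divisorClassesSpan)
open Summit.HodgeConjecture.CorCM.GaloisRank

variable {K : Type} [Field K] [NumberField K] [IsCMField K] [IsGalois ℚ K]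

set_option synthInstance.maxSize 4096 in
/-- `GL(2,3)`: order `48`, and an involution `u` with three elements `1, g₁, g₂` exhibiting three distinct conjugates
(`g₁⁻¹ u g₁ ≠ u`, `g₂⁻¹ u g₂ ≠ u`, `(g₂⁻¹ g₁) u (g₂⁻¹ g₁)⁻¹ ≠ u`) — found by `decide +kernel`. [folklore] -/
theorem gl_two_three_involution_three_conjugates : Fintype.card (GL (Fin 2) (ZMod 3)) = 48 ∧
    ∃ u g₁ g₂ : GL (Fin 2) (ZMod 3), u * u = 1 ∧ g₁⁻¹ * u * g₁ ≠ u ∧ g₂⁻¹ * u * g₂ ≠ u ∧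
      g₂⁻¹ * g₁ * u * (g₂⁻¹ * g₁)⁻¹ ≠ u := by
  refine ⟨by decide +kernel, by decide +kernel⟩

/-- **`Gal(K/ℚ) ≅ GL(2,3)`: a simple DEGENERATE abelian `24`-fold with CM by `K`** and a rational `(q,q)` class outside the divisor
ring on some power (skew CM set from the family count with `m₀ = 3`; complex conjugation is `-1`, the only central involution, but
need not be located). [cite: Shimura1998, §6.2 Thm. 3, §8.2 Prop. 26 and §32.10] [cite: Gordon1999HodgeAVSurvey, Thm. 6.4 and §9.3] -/
theorem exists_simple_degenerate_of_mulEquiv_gl_two_three (e : (K ≃ₐ[ℚ] K) ≃* GL (Fin 2) (ZMod 3)) :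
    ∃ (Φ : CMType K) (φ₀ : K →+* ℂ) (A : AbelianVariety ℂ) (ι : 𝓞 K →+* End A)
      (θ : K →+* Module.End ℂ (complexBetti A.X 1)),
      IsPrimitive (ℂ ≃+* ℂ) Φ.1 φ₀ ∧ ¬ IsNondegenerate Φ ∧ IsCMTypeRealisation Φ A ι θ ∧ A.IsSimple ∧ A.dim = 24 ∧
      ∃ n p : ℕ, ∃ x : complexBetti (⨁ fun _ : Fin n => A).X (2 * p), IsRationalClass x ∧
        IsOfHodgeType (⨁ fun _ : Fin n => A).dim (⨁ fun _ : Fin n => A).X (2 * p) p p x ∧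
        x ∉ divisorClassesSpan (⨁ fun _ : Fin n => A).X (⨁ fun _ : Fin n => A).dim p := by
  classical
  obtain ⟨hcard, u, g₁, g₂, huu, h1, h2, h12⟩ := gl_two_three_involution_three_conjugates
  exact exists_simple_degenerate_of_involution_three_conjugates e u g₁ g₂ huu h1 h2 h12 hcard

end Summit.HodgeConjecture.CorCM.GaloisModels

end
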